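import Summits.AtomisticToContinuum.HydrodynamicLimit.Theses.ZenoDiameterTransfer

/-!
# Birth skeleton — piece X1 `DiluteFieldTwin` of the decomposition of `DiluteEntropicTwin`
(stmt-AtomisticToContinuum-12207; crux-strategist, 2026-08-17)

Two stubs and the composition `DiluteFieldTwin_of` (sorry-free; sorries only in the stubs):
* `stub_dhm_along_rate` — the OPEN content in theorem shape: every classical ideal Euler solution on `[0,T')`
  with unit mass determines an admissible RATE `R` (`R(ε) → ∞` as `ε → 0⁺`; Deng–Hani–Ma's (1.24):
  inverse Knudsen `(N+1)ε² ≲ (log|log ε|)^(1/4)`-type growth against the horizon `T'`) such that along EVERY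
  dilute diameter sequence obeying the rate (`(N+1)ε'³ → 0`, `(N+1)ε'² → ∞`, `(N+1)ε'² ≤ R(ε')` eventually),
  for all flows and normalisable canonical local-Gibbs data, the empirical fields converge in probability at
  every `s < T'` (DHM arXiv:2503.01800 Thm 3 (2) for canonical data: equivalence of ensembles + initial layer);
* `stub_rate_schedule` — provable now: below ANY rate `R → ∞` there is an admissible dilute schedule
  `0 < ε'_N < 1/2`, `(N+1)ε'³ → 0`, `(N+1)ε'² → ∞`, `(N+1)ε'² ≤ R(ε'_N)` eventually, carrying hard-sphere
  flows (Alexander, `HardSphereFlow.nonempty_torus_holds`) under which the canonical local Gibbs laws of given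
  continuous positive profiles are probability measures for EVERY `N` (`ε'_N ≤ ¼(N+1)^(-1/3)`: free volume
  positive, `volume_setOf_lt_euclidDist_pos` / `isProbabilityMeasure_localGibbsLaw` pattern; the diagonal
  `K(N) = max(k ≤ (N+1)^(1/4) : N+1 > k/η_k²)`, `ε'_N = min(√(K(N)/(N+1)), ¼(N+1)^(-1/3))`).
The composition is the diagonal choice: rate from stub 1, schedule + flows from stub 2, fields from stub 1.
-/

namespace Summit.AtomisticToContinuum.HydrodynamicLimit.Cruxes.DiluteEntropicTwin.DiluteFieldTwin

set_option linter.dupNamespace false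

open scoped BigOperators Topology ENNReal
open Filter Set MeasureTheory

/-- The piece (verbatim the staged sub-item `DiluteFieldTwin`). -/
def DiluteFieldTwin : Prop :=
  ∀ (T' : ℝ) (ρ' θ' : ℝ → Literature.MathematicalPhysics.KineticTheory.T3 → ℝ) (u' : ℝ → Literature.MathematicalPhysics.KineticTheory.T3 → Literature.MathematicalPhysics.KineticTheory.V3), Literature.MathematicalPhysics.KineticTheory.IsHardSphereEulerSolution 0 T' ρ' u' θ' → 0 < T' → (∫ x, ρ' 0 x = 1) → ∃ ε' : ℕ → ℝ, (∀ N : ℕ, 0 < ε' N ∧ ε' N < 2⁻¹) ∧ Filter.Tendsto (fun N : ℕ => ((N : ℝ) + 1) * ε' N ^ 3) Filter.atTop (nhds 0) ∧ Filter.Tendsto (fun N : ℕ => ((N : ℝ) + 1) * ε' N ^ 2) Filter.atTop Filter.atTop ∧ ∃ Φ' : (N : ℕ) → Literature.Analysis.FluidPDE.HardSphereFlow (Literature.Analysis.FluidPDE.Torus.geometry (Fin 3)) (ε' N) (N + 1), (∀ N : ℕ, MeasureTheory.IsProbabilityMeasure (Literature.Analysis.FluidPDE.particleLaw (Φ' N)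 (Literature.Analysis.FluidPDE.canonicalDensity (Literature.Analysis.FluidPDE.Torus.geometry (Fin 3)) (ε' N) (N + 1) (Literature.MathematicalPhysics.KineticTheory.localGibbsProfile (ρ' 0) (u' 0) (θ' 0))))) ∧ (∀ s ∈ Set.Ico 0 T', Literature.MathematicalPhysics.KineticTheory.TendstoHydroFieldsAt (fun N => (Literature.Analysis.FluidPDE.particleLaw (Φ' N) (Literature.Analysis.FluidPDE.canonicalDensity (Literature.Analysis.FluidPDE.Torus.geometry (Fin 3)) (ε' N) (N + 1) (Literature.MathematicalPhysics.KineticTheory.localGibbsProfile (ρ' 0) (u' 0) (θ' 0))))) Φ' ρ' u' θ' s)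

/-- Stub 1 — Deng–Hani–Ma along admissible rates, canonical local-Gibbs data (OPEN). -/
theorem stub_dhm_along_rate :
    ∀ (T' : ℝ) (ρ' θ' : ℝ → Literature.MathematicalPhysics.KineticTheory.T3 → ℝ) (u' : ℝ → Literature.MathematicalPhysics.KineticTheory.T3 → Literature.MathematicalPhysics.KineticTheory.V3), Literature.MathematicalPhysics.KineticTheory.IsHardSphereEulerSolution 0 T' ρ' u' θ' → 0 < T' → (∫ x, ρ' 0 x = 1) → ∃ R : ℝ → ℝ, Filter.Tendsto R (nhdsWithin 0 (Set.Ioi 0)) Filter.atTop ∧ ∀ ε' : ℕ → ℝ, (∀ N : ℕ, 0 < ε' N ∧ ε' N < 2⁻¹) → Filter.Tendsto (fun N : ℕ => ((N : ℝ) + 1) * ε' N ^ 3) Filter.atTop (nhds 0) → Filter.Tendsto (fun N : ℕ => ((N : ℝ) + 1) * ε' N ^ 2) Filter.atTop Filter.atTop → (∀ᶠ N : ℕ in Filter.atTop, ((N : ℝ) + 1) * ε' N ^ 2 ≤ R (ε' N)) → ∀ Φ' : (N : ℕ) → Literature.Analysis.FluidPDE.HardSphereFlow (Literature.Analysis.FluidPDE.Torus.geometry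 (Fin 3)) (ε' N) (N + 1), (∀ N : ℕ, MeasureTheory.IsProbabilityMeasure (Literature.Analysis.FluidPDE.particleLaw (Φ' N) (Literature.Analysis.FluidPDE.canonicalDensity (Literature.Analysis.FluidPDE.Torus.geometry (Fin 3)) (ε' N) (N + 1) (Literature.MathematicalPhysics.KineticTheory.localGibbsProfile (ρ' 0) (u' 0) (θ' 0))))) → ∀ s ∈ Set.Ico 0 T', Literature.MathematicalPhysics.KineticTheory.TendstoHydroFieldsAt (fun N => (Literature.Analysis.FluidPDE.particleLaw (Φ' N) (Literature.Analysis.FluidPDE.canonicalDensity (Literature.Analysis.FluidPDE.Torus.geometry (Fin 3)) (ε' N) (N + 1) (Literature.MathematicalPhysics.KineticTheory.localGibbsProfile (ρ' 0) (u' 0) (θ' 0))))) Φ' ρ' u' θ' s := by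
  sorry

/-- Stub 2 — admissible normalisable dilute schedules exist below any rate (provable now). -/
theorem stub_rate_schedule :
    ∀ R : ℝ → ℝ, Filter.Tendsto R (nhdsWithin 0 (Set.Ioi 0)) Filter.atTop → ∀ (a₀ θ₀ : Literature.MathematicalPhysics.KineticTheory.T3 → ℝ) (u₀ : Literature.MathematicalPhysics.KineticTheory.T3 → Literature.MathematicalPhysics.KineticTheory.V3), Continuous a₀ → Continuous θ₀ → Continuous u₀ → (∀ x, 0 < a₀ x) → (∀ x, 0 < θ₀ x) → ∃ ε' : ℕ → ℝ, (∀ N : ℕ, 0 < ε' N ∧ ε' N < 2⁻¹) ∧ Filter.Tendsto (fun N : ℕ => ((N : ℝ) + 1) * ε' N ^ 3) Filter.atTop (nhds 0) ∧ Filter.Tendsto (fun N : ℕ => ((N : ℝ) + 1) * ε' N ^ 2) Filter.atTop Filter.atTop ∧ (∀ᶠ N : ℕ in Filter.atTop, ((N : ℝ) + 1) * ε' N ^ 2 ≤ R (ε' N)) ∧ ∃ Φ' : (N : ℕ) → Literature.Analysis.FluidPDE.HardSphereFlow (Literature.Analysis.FluidPDE.Torus.geometry (Fin 3)) (ε' N)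 (N + 1), ∀ N : ℕ, MeasureTheory.IsProbabilityMeasure (Literature.Analysis.FluidPDE.particleLaw (Φ' N) (Literature.Analysis.FluidPDE.canonicalDensity (Literature.Analysis.FluidPDE.Torus.geometry (Fin 3)) (ε' N) (N + 1) (Literature.MathematicalPhysics.KineticTheory.localGibbsProfile a₀ u₀ θ₀))) := by
  sorry

/-- **Composition** (kernel-checked): the diagonal choice. -/
theorem DiluteFieldTwin_of : DiluteFieldTwin := by
  have hS1 := stub_dhm_along_rate
  have hS2 := stub_rate_schedule
  intro T' ρ' θ' u' hE hT hmass
  have h0 : (0 : ℝ) ∈ Set.Ico 0 T' := ⟨le_rfl, hT⟩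
  obtain ⟨R, hR, hdhm⟩ := hS1 T' ρ' θ' u' hE hT hmass
  obtain ⟨ε', hε', h3, h2, hrate, Φ', hprob⟩ := hS2 R hR (ρ' 0) (θ' 0) (u' 0)
    (hE.smooth_density.isSmooth_slice h0).continuous (hE.smooth_temperature.isSmooth_slice h0).continuous
    (hE.smooth_velocity.isSmooth_slice h0).continuous (hE.density_pos 0 h0) (hE.temperature_pos 0 h0)
  exact ⟨ε', hε', h3, h2, Φ', hprob, fun s hs => hdhm ε' hε' h3 h2 hrate Φ' hprob s hs⟩

end Summit.AtomisticToContinuum.HydrodynamicLimit.Cruxes.DiluteEntropicTwin.DiluteFieldTwin
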